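import Mathlib
import HarnessLib
import Summits.HubbardSuperconductivity.HubbardSuperconductivity.Theorems.KLProgrammeKLRegimeEngineE4FlowWitness
import Summits.HubbardSuperconductivity.HubbardSuperconductivity.Theorems.KLProgrammeKLRegimeEngineTowerImportWt
import Summits.HubbardSuperconductivity.HubbardSuperconductivity.Theorems.KLProgrammeKLRegimeEngineAnisoLineFromPlainWt

/-!
# Route `KLProgramme` — crux K3 ENGINE (stmt-HubbardSuperconductivity-20437 `KLRegimeEngineV17F2`), stub (b) closing path, E1 row E-b3: the level-`n` WEIGHTED
# PER-TUPLE LINE `WtTupleLineAt … (K_n) n` FROM THE WEIGHTED PLAIN FOUR-LEG LINE of `𝒱_n[K_n]` — brick (T3w) of «WT-NORM-BRICK»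

Cell gate-hubbard-kl, seat hubbard-kl-k3c2-p3 (g17; row «sector-counting import»).  E-b3 of the pen's E1 docket ((R394)(F), (R416)(B)(5)) is the level-`n`
WEIGHTED per-tuple line `WtTupleLineAt L M a b P β U μ (K_n) n` (`…EngineE4FlowWitness`: for every anisotropic label 4-tuple `Ω`, the `klScaleWt n`-weighted position
sum of the sectorised quartic kernel of `𝒱_n[K_n]` with leg `0` at the origin is `≤ klE0·(a·Klam|U| + b·(Klam U)²)`) — the input of the (E4) first-moments witness
`e4FlowAt_of_wtTupleLine`.  By this lineage's weighted aniso-from-plain transfer (`wprescribedSum_klAniso_le_of_plain_treeWt`, g15) and the weighted single-multiplier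
character sum on the flow frame (`charSumWt_klAniso_single_flow_all`, g15, on p4/k3c3's `charSumWt_nbPair_klEng_flow_all`) it REDUCES to the `klScaleWt_n`-weighted PLAIN
four-leg pinned line of `𝒱_n[K_n]` at leg `0` — which (T2w) `wplainFourLegLine_of_pairTransfer_superposition` (…TowerImportP2PlainFromValuesWt) reads from the SAME
momentum-space pair-transfer representation as the (X).1 plain line.  So after this file E1's four-leg items on the (b) path ((X).1 conj 1, E-b2(4), E-b3) read ONE
representation.

* **`wtTupleLine_le_of_wplainLine_klEng_flow_all (R c″)`** — `∃ CW > 0`: under the binders of `charSumWt_klAniso_single_flow_all` (`R.WF2`, `0 < cc ≤ klEngC₃6 P R`,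
  `μ ∈ klWindowC`, `0 < U ≤ min (klEngU₀3 P R cc) (1/(Gfr₃+1))`, `c″U ≤ 1`, `klBetaMin ≤ β ≤ e^{cc/U²}`, `klEngL₃`, `klEngM₃`, `1 ≤ n ≤ n_β+1`, `IsKLRegime`, `HistP klPredsV17F2 … 0 n`,
  the `FlowPieceOscAt` rows), for every `N₁ ≥ 0` bounding the `klScaleWt_n`-weighted PLAIN four-leg pinned sums of `𝒱_n[K_n]` at leg `0` (every spin/charge string, every
  pin): for every anisotropic 4-tuple `Ω`, the E-b3 left side is `≤ CW⁴·N₁`;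
* **`wtTupleLineAt_of_wplainLine_klEng_flow_all (R c″)`** — hence `CW⁴·N₁ ≤ klE0·(a·(P.Klam·|U|) + b·(P.Klam·U)²)` ⇒ `WtTupleLineAt L M a b P β U μ (K_n) n`.
Proofs only; the weighted plain line stays a hypothesis (E1 / (T2w)); nothing asserts `WtTupleLineAt` for the engine, any stub, K3 or superconductivity.
References: BGM 2006 §2.7 (2.70)–(2.71a), §2.8 (2.76)–(2.77), (2.82)–(2.84) [cite: BenfattoGiulianiMastropietro2006].
-/

noncomputable section

namespace Summit.HubbardSuperconductivity.HubbardSuperconductivity.Theorems.EngineV8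

set_option linter.dupNamespace false -- summit = problem name (single-conjunct summit), D-0017

open Classical
open Real Finset Literature.MathematicalPhysics.QuantumLattice Literature.Probability.LatticeModels GrassmannAlgebra
open Literature.Probability.LatticeModels.BattleFederbush
open Literature.MathematicalPhysics.QuantumLattice.FermiRG
open Summit.HubbardSuperconductivity.HubbardSuperconductivity.Theorems.KLProgrammeLegKernels
open Summit.HubbardSuperconductivity.HubbardSuperconductivity.Theorems.KLRegimeSplit
open Summit.HubbardSuperconductivity.HubbardSuperconductivity.Theorems.TorusFourierL2
open Summit.HubbardSuperconductivity.HubbardSuperconductivity.Theorems.DispersionFlow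
open Summit.HubbardSuperconductivity.HubbardSuperconductivity.Theorems.KLRegimeWick

variable {L M : ℕ} [NeZero L] [NeZero M]

/-- **THE E-b3 LEFT SIDE FROM THE WEIGHTED PLAIN FOUR-LEG LINE, AT THE FLOW FRAME**: `∃ CW > 0` such that, under the binders of `charSumWt_klAniso_single_flow_all`, for every
`N₁ ≥ 0` with `ε³·Σ_{x′ : x′ 0 = y} klScaleWt_n(pos x′)·‖W^{1}_4(𝒱_n[K_n])_{τ′}(x′)‖ ≤ N₁` for all `τ′, y`, and every anisotropic label 4-tuple `Ω`:
`ε³·Σ_{x : Fin 3 → ⋯} klScaleWt_n(pos (0 :: x, Ω))·‖klAnisoLegKernel … (K_n) klE0 n 4 Ω (0 :: x)‖ ≤ CW⁴·N₁` (`CW = CT/2`, `CT` of `charSumWt_klAniso_single_flow_all`).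
[cite: BenfattoGiulianiMastropietro2006, §2.7 (2.70)-(2.71a), §2.8 (2.82)-(2.84)] -/
theorem wtTupleLine_le_of_wplainLine_klEng_flow_all (R : RenConsts) (c'' : ℝ) (hc'' : 0 ≤ c'') :
    ∃ CW : ℝ, 0 < CW ∧
      ∀ (G : GeoConsts) (P : SplitConsts) (Q : EngConsts) (cc : ℝ), R.WF2 → 0 < cc → cc ≤ klEngC₃6 P R →
      ∀ μ ∈ klWindowC, ∀ U : ℝ, 0 < U → U ≤ min (klEngU₀3 P R cc) (1 / (R.Gfr 3 + 1)) → c'' * U ≤ 1 →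
      ∀ β : ℝ, klBetaMin ≤ β → β ≤ Real.exp (cc / U ^ 2) →
      ∀ (L M : ℕ) [NeZero L] [NeZero M], klEngL₃ β U ≤ L → klEngM₃ β U L ≤ M →
      ∀ n : ℕ, 1 ≤ n → n ≤ nScales β + 1 → IsKLRegime U cc (-(n : ℤ)) → HistP klPredsV17F2 L M G P Q R β U μ 0 n →
        (∀ m', 1 ≤ m' → m' < n → FlowPieceOscAt L M c'' β U μ m') →
        ∀ N₁ : ℝ, 0 ≤ N₁ →
          (∀ (τ' : Fin 4 → SectorLeg 1) (y : SpaceTimeIdx L M),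
            imagTimeWeight β M ^ 3 * ∑ x' ∈ univ.filter (fun x' : Fin 4 → SpaceTimeIdx L M => x' 0 = y),
              klScaleWt L M β n ((univ.image x').image (fun x : SpaceTimeIdx L M => (((((2 * (x.1 : ℕ) : ℕ)) : ZMod (2 * (2 * M)))), x.2))) *
                ‖sectorisedKernel L M β (trivialMultiplier L M)
                  (klEffectiveAction L M β U μ (klFlowFrameU L M β U μ n) klE0 n) 4 τ' x'‖ ≤ N₁) →
          ∀ Ω : Fin 4 → SectorLeg (sectorCount n),
            imagTimeWeight β M ^ 3 *
                ∑ x : Fin 3 → SpaceTimeIdx L M,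
                  klScaleWt L M β n ((univ.image (fun j : Fin 4 => (Matrix.vecCons (0 : SpaceTimeIdx L M) x j, Ω j))).image
                      (latticeLegPos (2 * (2 * M)))) *
                    ‖klAnisoLegKernel L M β U μ (klFlowFrameU L M β U μ n) klE0 n 4 Ω (Matrix.vecCons (0 : SpaceTimeIdx L M) x)‖ ≤
              CW ^ 4 * N₁ := by
  obtain ⟨CT, hCT, hT⟩ := charSumWt_klAniso_single_flow_all R c'' hc''
  refine ⟨CT / 2, by positivity, ?_⟩
  intro G P Q cc hR2 hcc hcc6 μ hμ U hU hUle hcU β hβmin hβc L M _ _ hL3 hM3 n hn1 hnN hreg hhist hosc N₁ hN₁0 hplain Ω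
  have hβ0 : 0 < β := KLRegimeSplit.pos_of_klBetaMin_le hβmin
  have hM0 : (0 : ℝ) < M := Nat.cast_pos.2 (Nat.pos_of_ne_zero (NeZero.ne M))
  have hL0 : (0 : ℝ) < L := Nat.cast_pos.2 (Nat.pos_of_ne_zero (NeZero.ne L))
  set K : TrigPolyC4v := klFlowFrameU L M β U μ n with hK
  set 𝒱 : HubbardGrassmann L M := klEffectiveAction L M β U μ K klE0 n with h𝒱
  set gpos : SpaceTimeIdx L M → ZMod (2 * (2 * M)) × TorusSite 2 L :=
    fun x => (((((2 * (x.1 : ℕ) : ℕ)) : ZMod (2 * (2 * M)))), x.2) with hgpos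
  -- the weighted single-multiplier character sums at `J = n`, rate `n`
  have hT₁ := fun ω => hT G P Q cc hR2 hcc hcc6 μ hμ U hU hUle hcU β hβmin hβc L M hL3 hM3 n hn1 hnN hreg hhist hosc n n hn1 le_rfl le_rfl ω
  have hT0 : 0 ≤ CT * M * (L : ℝ) ^ 2 := by positivity
  have hc0 : 0 ≤ CT * M * (L : ℝ) ^ 2 / (β * (L : ℝ) ^ 2) := by positivity
  obtain ⟨hrowS, hcolS⟩ := transferSumsWt_klAniso_single_le hβ0 μ K n n hT₁
  have hwt : IsTreeWeight (klScaleWt L M β n) := isTreeWeight_klScaleWt L M hβ0.le n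
  -- the weighted aniso all-fixed line at the tuple `Ω`, leg `0` pinned at the origin
  have hline := wprescribedSum_klAniso_le_of_plain_treeWt hwt gpos hβ0 μ K n 𝒱 hc0 hc0 hN₁0
    (fun ω'' σ' c x' => hcolS ω'' σ' c x') (fun ω'' σ' c x'' => hrowS ω'' σ' c x'') 3 Ω 0 hplain 0
  -- rewrite the E-b3 sum (over `x : Fin 3 → ⋯` with leg `0` at the origin) as the pinned sum through leg `0`
  have hsum : ∑ x : Fin 3 → SpaceTimeIdx L M,
      klScaleWt L M β n ((univ.image (fun j : Fin 4 => (Matrix.vecCons (0 : SpaceTimeIdx L M) x j, Ω j))).image (latticeLegPos (2 * (2 * M)))) *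
        ‖klAnisoLegKernel L M β U μ K klE0 n 4 Ω (Matrix.vecCons (0 : SpaceTimeIdx L M) x)‖ =
      ∑ x'' ∈ univ.filter (fun x'' : Fin 4 → SpaceTimeIdx L M => x'' 0 = 0),
        klScaleWt L M β n ((univ.image x'').image gpos) * ‖sectorisedKernel L M β (klAnisoFamily L M β μ K klE0 n) 𝒱 4 Ω x''‖ := by
    rw [sum_filter_apply_eq]
    refine sum_congr rfl fun x _ => ?_
    rw [Fin.insertNth_zero']
    have hw : (univ.image (fun j : Fin 4 => (Matrix.vecCons (0 : SpaceTimeIdx L M) x j, Ω j))).image (latticeLegPos (2 * (2 * M))) =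
        (univ.image (Fin.cons (0 : SpaceTimeIdx L M) x : Fin 4 → SpaceTimeIdx L M)).image gpos := by
      rw [image_latticeLegPos_eq_image_pos]
      rfl
    rw [hw]
    rfl
  rw [hsum]
  refine hline.trans (le_of_eq ?_)
  have hq : CT * M * (L : ℝ) ^ 2 / (β * (L : ℝ) ^ 2) * imagTimeWeight β M = CT / 2 := by
    unfold imagTimeWeight
    field_simp
  calc (CT * M * (L : ℝ) ^ 2 / (β * (L : ℝ) ^ 2)) ^ 3 * (CT * M * (L : ℝ) ^ 2 / (β * (L : ℝ) ^ 2)) * imagTimeWeight β M ^ (3 + 1) * N₁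
      = (CT * M * (L : ℝ) ^ 2 / (β * (L : ℝ) ^ 2) * imagTimeWeight β M) ^ 4 * N₁ := by ring
    _ = (CT / 2) ^ 4 * N₁ := by rw [hq]

/-- **E-b3 FROM THE WEIGHTED PLAIN FOUR-LEG LINE** (`WtTupleLineAt` at the flow frame): with `CW` of `wtTupleLine_le_of_wplainLine_klEng_flow_all`, under the same binders, if the
`klScaleWt_n`-weighted plain four-leg pinned sums of `𝒱_n[K_n]` at leg `0` are `≤ N₁` and `CW⁴·N₁ ≤ klE0·(a·(P.Klam·|U|) + b·(P.Klam·U)²)`, then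
`WtTupleLineAt L M a b P β U μ (klFlowFrameU L M β U μ n) n` — the input of `e4FlowAt_of_wtTupleLine`.  ((T2w) supplies `N₁ = κ·√(6561988608·n₀)·V + r` from the (X).1
representation; with child 1's `V = (11/9)U + C·U²` this is the `a·U + b·U²` shape.) [cite: BenfattoGiulianiMastropietro2006, §2.8 (2.76)-(2.77)] -/
theorem wtTupleLineAt_of_wplainLine_klEng_flow_all (R : RenConsts) (c'' : ℝ) (hc'' : 0 ≤ c'') :
    ∃ CW : ℝ, 0 < CW ∧
      ∀ (G : GeoConsts) (P : SplitConsts) (Q : EngConsts) (cc : ℝ), R.WF2 → 0 < cc → cc ≤ klEngC₃6 P R →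
      ∀ μ ∈ klWindowC, ∀ U : ℝ, 0 < U → U ≤ min (klEngU₀3 P R cc) (1 / (R.Gfr 3 + 1)) → c'' * U ≤ 1 →
      ∀ β : ℝ, klBetaMin ≤ β → β ≤ Real.exp (cc / U ^ 2) →
      ∀ (L M : ℕ) [NeZero L] [NeZero M], klEngL₃ β U ≤ L → klEngM₃ β U L ≤ M →
      ∀ n : ℕ, 1 ≤ n → n ≤ nScales β + 1 → IsKLRegime U cc (-(n : ℤ)) → HistP klPredsV17F2 L M G P Q R β U μ 0 n →
        (∀ m', 1 ≤ m' → m' < n → FlowPieceOscAt L M c'' β U μ m') →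
        ∀ N₁ : ℝ, 0 ≤ N₁ →
          (∀ (τ' : Fin 4 → SectorLeg 1) (y : SpaceTimeIdx L M),
            imagTimeWeight β M ^ 3 * ∑ x' ∈ univ.filter (fun x' : Fin 4 → SpaceTimeIdx L M => x' 0 = y),
              klScaleWt L M β n ((univ.image x').image (fun x : SpaceTimeIdx L M => (((((2 * (x.1 : ℕ) : ℕ)) : ZMod (2 * (2 * M)))), x.2))) *
                ‖sectorisedKernel L M β (trivialMultiplier L M)
                  (klEffectiveAction L M β U μ (klFlowFrameU L M β U μ n) klE0 n) 4 τ' x'‖ ≤ N₁) →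
          ∀ a b : ℝ, CW ^ 4 * N₁ ≤ klE0 * (a * (P.Klam * |U|) + b * (P.Klam * U) ^ 2) →
            WtTupleLineAt L M a b P β U μ (klFlowFrameU L M β U μ n) n := by
  obtain ⟨CW, hCW, h⟩ := wtTupleLine_le_of_wplainLine_klEng_flow_all R c'' hc''
  refine ⟨CW, hCW, ?_⟩
  intro G P Q cc hR2 hcc hcc6 μ hμ U hU hUle hcU β hβmin hβc L M _ _ hL3 hM3 n hn1 hnN hreg hhist hosc N₁ hN₁0 hplain a b hab Ω
  exact (h G P Q cc hR2 hcc hcc6 μ hμ U hU hUle hcU β hβmin hβc L M hL3 hM3 n hn1 hnN hreg hhist hosc N₁ hN₁0 hplain Ω).trans hab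

end Summit.HubbardSuperconductivity.HubbardSuperconductivity.Theorems.EngineV8

end
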